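import Summits.AnomalousDissipation.AnomalousDissipation.Theorems.QuarticTightness.Negative.Anatomy
import Summits.AnomalousDissipation.AnomalousDissipation.Theorems.MomentParityMomentClosure

/-!
# Stub `stub_invariantOfLadder` (S10) of the line `horizon-shooting` (payload `Ideate3Sketch`)
# for the crux `MomentParity.QuarticTightness` (stmt-AnomalousDissipation-14331)

Sorry-free discharge of the registered stub `stub_invariantOfLadder` of the lead's skeleton: the
`κ`-FREE POLYNOMIAL MOMENT CLOSURE AT ONE LEVEL.

**Statement.**  At fixed `(f, ν, N, R, E, ε)` (`f` smooth): if for EVERY moment order `d` there is a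
ladder witness `μ_d` (`IsLadderWitness f ν N R d E ε μ_d`: a level-`N` probability law on `H` carried by
the ball `‖u‖ ≤ R`, `d`-stationary for Galerkin NS, mean energy `≤ E`, dissipation `≥ ε`; the law may
depend on `d`), then there is ONE invariant witness (`IsInvariantWitness f ν N R E ε μ'`: the same
clauses with polynomial stationarity of ALL orders at once).

**Proof.**  Verbatim the proof of `momentClosure_proof` (`Theorems/MomentParityMomentClosure`) with the
tail clause and the `C¹` upgrade dropped.
1. CARRIER. Every `μ_d` is carried by the level ball `K = {u level-N, ‖u‖ ≤ R}`, compact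
   (`MomentParityMomentClosure.isCompact_levelBall`); `0 ≤ R` because `μ_0` is a probability measure.
2. LIMIT. `MomentParityMomentClosure.exists_limit_measure_of_isCompact` gives a probability measure `μ'`
   carried by `K` with `∫ F dμ' ∈ C` whenever `F : H → ℝ` is continuous, `C` closed and `∫ F dμ_d ∈ C`
   eventually in `d`.
3. ROWS. Each polynomial row `u ↦ ⟨F(u), ∇p(u)⟩` is continuous on `H`
   (`MomentParityMomentClosure.continuous_nsGeneratorPairing_polyGrad`), integrable on the compact
   carrier (`integrable_of_continuous_of_ae_mem`) and vanishes against `μ_d` as soon as `d ≥ deg p + 1`,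
   hence against `μ'` (closed set `{0}`); the energy `‖u‖²` is continuous (closed set `Iic E`); on the
   level ball the enstrophy is the continuous band enstrophy
   (`MomentParityMomentClosure.lintegral_eGradNormSq_eq`), so the dissipation floor is the closed
   condition `ε ≤ ν ∫ e_N`.

References: Foias–Manley–Rosa–Temam, *Navier–Stokes Equations and Turbulence* (CUP 2001) Ch. IV App. B
(weak-* limits of stationary statistical solutions of the Galerkin systems); Kraichnan-type moment
closures made exact in the limit `d → ∞`. No new definitions; no theorem here concludes a Theses decl.
-/

noncomputable section

-- `Summit.<Summit>.<Problem>` is the tree's mandated summit-side namespace (CONVENTIONS §2); for this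
-- single-conjunct summit the two coincide, so the duplicate is deliberate.
set_option linter.dupNamespace false

namespace Summit.AnomalousDissipation.AnomalousDissipation.Theorems.MomentParityQuarticTightness

open MeasureTheory Filter Topology Set Function
open scoped ENNReal InnerProductSpace RealInnerProductSpace
open Literature.Analysis.FunctionSpaces Literature.Analysis.FunctionSpaces.Torus
open Literature.Analysis.FluidPDE Literature.Analysis.FluidPDE.Torus
open Summit.AnomalousDissipation.AnomalousDissipation.Theses.MomentParity
open Summit.AnomalousDissipation.AnomalousDissipation.Theorems
open Summit.AnomalousDissipation.AnomalousDissipation.Theorems.QuarticGate.Negative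
open Summit.AnomalousDissipation.AnomalousDissipation.Theorems.QuarticTightness.Negative

-- `T3 = T³`, `R3 = ℝ³`, `H3 = H`, `L2T3 = L²(T³; ℝ³)` (sibling crux's abbreviations).
open Summit.AnomalousDissipation.AnomalousDissipation.Theorems.CubicParityLoud.Negative (T3 R3 H3 L2T3)

-- the moment-closure helpers (compact level ball, weak-* limit, continuous rows)
open Summit.AnomalousDissipation.AnomalousDissipation.Theorems.MomentParityMomentClosure

/-- **S10 — `κ`-FREE POLYNOMIAL MOMENT CLOSURE AT ONE LEVEL.** At fixed `(f, ν, N, R, E, ε)`: ladder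
witnesses of EVERY order `d` in the ball `B_R` (each `d`-stationary, level-`N`, energy `≤ E`, dissipation
`≥ ε`; the measure may depend on `d`) yield ONE invariant witness in `B_R` with the same budgets (all-order
polynomially stationary): weak-* limit in `d` on the compact level ball (module docstring). [folklore] -/
theorem stub_invariantOfLadder {f : T3 → R3} (hfs : Torus.IsSmooth f) {ν : ℝ} {N : ℕ} {R E ε : ℝ}
    (h : ∀ d : ℕ, ∃ μ : Measure H3, IsLadderWitness f ν N R d E ε μ) :
    ∃ μ : Measure H3, IsInvariantWitness f ν N R E ε μ := by
  choose μ hμ using h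
  have hμP : ∀ d, IsProbabilityMeasure (μ d) := fun d => (hμ d).1
  have hμL : ∀ d, ∀ᵐ u ∂μ d, IsLevel N u := fun d => (hμ d).2.1
  have hμR : ∀ d, ∀ᵐ u ∂μ d, ‖u‖ ≤ R := fun d => (hμ d).2.2.1
  have hμS : ∀ d, IsPolyStationary ν f N d (μ d) := fun d => (hμ d).2.2.2.1
  have hμE : ∀ d, Torus.ensembleEnergy (μ d) ≤ E := fun d => (hμ d).2.2.2.2.1
  have hμD : ∀ d, ε ≤ Torus.ensembleDissipation ν (μ d) := fun d => (hμ d).2.2.2.2.2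
  have hf : Integrable f volume := hfs.integrable
  -- the support radius is nonnegative (the measures are probability measures)
  have hR : 0 ≤ R := by
    haveI := hμP 0
    obtain ⟨u, hu⟩ := (hμR 0).exists
    exact (norm_nonneg u).trans hu
  -- 1. the compact carrier
  set K : Set H3 := {u : H3 | IsLevel N u ∧ ‖u‖ ≤ R} with hK_def
  have hK : IsCompact K := isCompact_levelBall N hR
  have hμK : ∀ d, ∀ᵐ u ∂μ d, u ∈ K := fun d => (hμL d).and (hμR d)
  -- 2. the limit measure
  obtain ⟨μ', hμ'P, hμ'K, hlim⟩ := exists_limit_measure_of_isCompact hK μ hμP hμK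
  haveI := hμ'P
  refine ⟨μ', hμ'P, hμ'K.mono fun u hu => hu.1, hμ'K.mono fun u hu => hu.2, fun m g P hg => ?_,
    ?_, ?_⟩
  · -- 3a. generator rows: every polynomial test passes to the limit (`d ≥ deg P + 1` eventually)
    have hgs : ∀ i, Torus.IsSmooth (g i) := fun i => (hg i).1
    refine ⟨integrable_of_continuous_of_ae_mem hK hμ'K
      (continuous_nsGeneratorPairing_polyGrad ν hf hgs P), ?_⟩
    refine hlim _ (continuous_nsGeneratorPairing_polyGrad ν hf hgs P) {0} isClosed_singleton ?_
    filter_upwards [eventually_ge_atTop (P.totalDegree + 1)] with d hd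
    exact (hμS d m g P hg hd).2
  · -- 3b. mean energy
    exact hlim (fun u : H3 => ‖u‖ ^ 2) (continuous_norm.pow 2) (Set.Iic E) isClosed_Iic
      (Eventually.of_forall fun d => hμE d)
  · -- 3c. dissipation
    have hcl : IsClosed {t : ℝ | ε ≤ ν * t} :=
      isClosed_le continuous_const (continuous_const.mul continuous_id)
    have key := hlim _ (continuous_bandEnstrophy (Torus.freqBall N)) _ hcl
      (Eventually.of_forall fun d => by
        haveI := hμP d
        have h := hμD d
        rw [Torus.ensembleDissipation, Torus.ensembleEnstrophy, lintegral_eGradNormSq_eq hR (hμK d),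
          ENNReal.toReal_ofReal (integral_nonneg (bandEnstrophy_nonneg _))] at h
        exact h)
    rw [Torus.ensembleDissipation, Torus.ensembleEnstrophy, lintegral_eGradNormSq_eq hR hμ'K,
      ENNReal.toReal_ofReal (integral_nonneg (bandEnstrophy_nonneg _))]
    exact key

end Summit.AnomalousDissipation.AnomalousDissipation.Theorems.MomentParityQuarticTightness

end
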